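import Mathlib.CategoryTheory.Galois.Equivalence

/-!
# Objects of a connected anabelioid from finite continuous `π₁`-sets

Grothendieck's Galois theory [SGA1, Exp. V §4–5] as used in Mochizuki, *The geometry of
anabelioids*, Publ. RIMS **40** (2004), §1.1 p. 10 [cite: MochizukiGeoAn2004, §1.1 p.10]: for a
connected anabelioid `C` with basepoint (fibre functor) `F` and `π₁ = Aut F`, "the category of finite
sets with continuous `π₁`-action" is equivalent to `C` via `F` (Mathlib: `functorToContAction F` is an
equivalence).  This file extracts the element-level consequence needed to BUILD objects with prescribed
fibres: every finite `Aut F`-set with open stabilisers is `Aut F`-equivariantly the fibre `F(X)` of some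
object `X` (`exists_obj_of_aut_action`).  Used for the "free" and "quotient" finite étale coverings in
the Galois-countability fact [IUTchI] Rmk. 2.5.3 (i) (T4).  Proof-only (no definitions).
-/

namespace Literature.AnabelianGeometry.Anabelioids

open CategoryTheory CategoryTheory.PreGaloisCategory
open scoped FintypeCatDiscrete

universe w u₂ u₁

variable {C : Type u₁} [Category.{u₂} C] [GaloisCategory C] (F : C ⥤ FintypeCat.{w}) [FiberFunctor F]

/-- **Objects from `π₁`-sets**: a finite `Aut F`-set `Y` all of whose stabilisers are open is,
`Aut F`-equivariantly, the fibre of an object of `C`. [cite: MochizukiGeoAn2004, §1.1 p.10] -/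
theorem exists_obj_of_aut_action (Y : Type w) [Finite Y] [MulAction (Aut F) Y]
    (hY : ∀ y : Y, IsOpen (MulAction.stabilizer (Aut F) y : Set (Aut F))) :
    ∃ (X : C) (e : F.obj X ≃ Y), ∀ (σ : Aut F) (x : F.obj X), e (σ • x) = σ • e x := by
  classical
  letI : Fintype Y := Fintype.ofFinite Y
  let A : Action FintypeCat.{w} (Aut F) := Action.FintypeCat.ofMulAction (Aut F) (FintypeCat.of Y)
  -- the action is continuous (finite discrete set, open stabilisers)
  have hc : Action.IsContinuous A := by
    rw [Action.isContinuous_def]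
    haveI : DiscreteTopology ((forget₂ (Action FintypeCat.{w} (Aut F)) TopCat).obj A) := ⟨rfl⟩
    refine continuous_prod_of_discrete_right.mpr fun y => ?_
    change Continuous fun σ : Aut F => σ • (y : Y)
    refine continuous_discrete_rng.mpr fun y' => ?_
    by_cases h : ∃ σ₀ : Aut F, σ₀ • y = y'
    · obtain ⟨σ₀, rfl⟩ := h
      have : (fun σ : Aut F => σ • y) ⁻¹' {σ₀ • y} =
          (fun σ => σ₀⁻¹ * σ) ⁻¹' (MulAction.stabilizer (Aut F) y : Set (Aut F)) := by
        ext σ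
        simp only [Set.mem_preimage, Set.mem_singleton_iff, SetLike.mem_coe,
          MulAction.mem_stabilizer_iff, mul_smul, inv_smul_eq_iff]
      rw [this]
      exact (hY y).preimage (continuous_const.mul continuous_id)
    · have : (fun σ : Aut F => σ • y) ⁻¹' {y'} = ∅ := by
        ext σ
        simp only [Set.mem_preimage, Set.mem_singleton_iff, Set.mem_empty_iff_false, iff_false]
        exact fun hσ => h ⟨σ, hσ⟩
      rw [this]
      exact isOpen_empty
  let A' : ContAction FintypeCat.{w} (Aut F) := ⟨A, hc⟩
  let X : C := (functorToContAction F).objPreimage A'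
  let i : (functorToContAction F).obj X ≅ A' := (functorToContAction F).objObjPreimageIso A'
  let j : (functorToAction F).obj X ≅ A := (ObjectProperty.ι _).mapIso i
  let e : F.obj X ≃ Y := FintypeCat.equivEquivIso.symm ((Action.forget _ _).mapIso j)
  refine ⟨X, e, fun σ x => ?_⟩
  have := congrFun (congrArg (fun k : F.obj X ⟶ FintypeCat.of Y => (k : F.obj X → Y))
    (j.hom.comm σ)) x
  exact this

end Literature.AnabelianGeometry.Anabelioids
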